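import Literature.AlgebraicGeometry.Modules.CechTheta
import Literature.AlgebraicGeometry.Motives.ChernClassesProofs
import Literature.Algebra.Homology.IteratedExtClassFunctor
import Literature.Algebra.Homology.ExtOneShortExact
import HarnessLib

/-!
# A Čech `2`-cocycle with vanishing `Ext`-class is a coboundary on a refinement

Let `𝓤 = (U_a)_{a : ι}` be an open cover of a scheme `X`, `E, M` two `𝒪_X`-modules and
`ω = (ω_{abc} : E|_{U_{abc}} → M|_{U_{abc}})` a Čech `2`-cocycle of local homomorphisms, with
`Ext`-class `[ω] = θ(ω♯) ∈ Ext²(E, M)` (`Cech.classOf`, computed with the exact Čech resolution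
`M → Č•(𝓤, M)`). We prove the converse of "coboundaries have zero class"
(`Cech.classOf_eq_zero_of_eq_dFamily`) in the form used by obstruction theory:

* `Cech.exists_refinement_eq_dFamily_of_classOf_eq_zero` — **if `[ω] = 0` then `ω|_𝓥 = dβ` on a
  refinement `𝓥 = (V_a ≤ U_a)_a` with the same index set**, for some `1`-cochain `β` of local
  homomorphisms on `𝓥` — PROVIDED every extension `0 → Č⁰(𝓤, M) → X' → E → 0` becomes split over
  the members of some such refinement (a "local retraction oracle" supplied by the user; e.g. for
  `E` finite locally free every extension by `E` splits near every point,
  `KTheory.exists_isSplitMono_over_of_shortExact`).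

Proof: `θ(ω♯) = 0` lifts `[ω̄] ∘ [T₁]` to some `y ∈ Ext¹(E, Č⁰(𝓤, M))`
(`ExactAugmentation.exists_ext_one_of_theta_eq_zero`); `y` is the class of an extension
`0 → Č⁰(𝓤, M) → X' → E → 0` (`Ext.exists_shortExact_extClass_eq`); retractions of it over the
`V_a` assemble (`Cech.homMk`) into `ρ : X' → Č⁰(𝓥, M)` through which the refinement map factors,
so `y ∘ [refine⁰] = 0`; hence `ω♯ ≫ refine² = β' ≫ d` (`exists_eq_comp_d_of_comp_eq_zero`), and
every morphism `E → Č¹(𝓥, M)` is `β♯` for a unique cochain `β` (`Cech.familyOfHom`).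

Also: `overHomMk` (morphisms `E|_U → M|_U` from sectionwise data); `familyOfHom` and `familyHom`
are inverse bijections (`familyHom_familyOfHom`, `familyOfHom_familyHom`, `familyHom_injective`).

## References

* R. Hartshorne, *Algebraic Geometry*, III Lemma 4.4 and Ex. III.4.4. [Hartshorne1977]
* The Stacks Project, Tags 01EW, 08L8. [StacksProject]
-/

noncomputable section

universe u

open CategoryTheory CategoryTheory.Abelian AlgebraicGeometry Opposite TopologicalSpace Limits

namespace Literature.AlgebraicGeometry.Modules

open Literature.AlgebraicGeometry.Motives

/-! ### Morphisms `E|_U → M|_U` from sectionwise data -/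

section OverHomMk

variable {X : Scheme.{u}} {E M : X.Modules} {U : X.Opens}

/-- **A morphism `E|_U → M|_U` from sectionwise data**: additive maps `f_k : Γ(E, W) → Γ(M, W)`
for all `k : W ⟶ U`, `𝒪(W)`-linear and natural in `W`. [folklore] -/
def overHomMk (f : ∀ ⦃W : X.Opens⦄, (W ⟶ U) → (Γ(E, W) →+ Γ(M, W)))
    (hsmul : ∀ ⦃W : X.Opens⦄ (k : W ⟶ U) (r : Γ(X, W)) (s : Γ(E, W)), f k (r • s) = r • f k s)
    (hnat : ∀ ⦃W V : X.Opens⦄ (k : W ⟶ U) (k' : V ⟶ U) (l : V ⟶ W) (s : Γ(E, W)),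
      f k' (E.presheaf.map l.op s) = M.presheaf.map l.op (f k s)) :
    E.over U ⟶ M.over U where
  val := PresheafOfModules.homMk
    { app := fun W => AddCommGrpCat.ofHom (f W.unop.hom)
      naturality := fun {W V} g => by
        ext s
        change f V.unop.hom (E.presheaf.map g.unop.left.op s) =
          M.presheaf.map g.unop.left.op (f W.unop.hom s)
        exact hnat _ _ _ s }
    (fun W r s => hsmul W.unop.hom r s)

/-- Values of `overHomMk`. [folklore] -/
@[simp] lemma appLE_overHomMk (f : ∀ ⦃W : X.Opens⦄, (W ⟶ U) → (Γ(E, W) →+ Γ(M, W)))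
    (hsmul : ∀ ⦃W : X.Opens⦄ (k : W ⟶ U) (r : Γ(X, W)) (s : Γ(E, W)), f k (r • s) = r • f k s)
    (hnat : ∀ ⦃W V : X.Opens⦄ (k : W ⟶ U) (k' : V ⟶ U) (l : V ⟶ W) (s : Γ(E, W)),
      f k' (E.presheaf.map l.op s) = M.presheaf.map l.op (f k s))
    {W : X.Opens} (k : W ⟶ U) (s : Γ(E, W)) :
    appLE (overHomMk f hsmul hnat) k s = f k s := rfl

end OverHomMk

namespace Cech

variable {X : Scheme.{u}} {ι : Type u} {U : ι → X.Opens} {n : ℕ} {E M : X.Modules}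

/-- Restriction of `𝒪_X` along `W ≤ W` is the identity. [folklore] -/
lemma resO_self {W : X.Opens} (h : W ≤ W) (r : Γ(X, W)) : resO (X := X) h r = r := by
  have : homOfLE h = 𝟙 W := Subsingleton.elim _ _
  change (X.presheaf.map (homOfLE h).op) r = r
  rw [this, op_id, X.presheaf.map_id]
  rfl

/-- Restriction of sections of `M` along a morphism of opens is `res`. [folklore] -/
lemma presheaf_map_eq_res {V W : X.Opens} (l : W ⟶ V) (s : Γ(M, V)) :
    M.presheaf.map l.op s = res M l.le s := by
  rw [Subsingleton.elim l (homOfLE l.le)]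

/-! ### Every morphism `E → Čⁿ(𝓤, M)` is `β♯` -/

/-- **The cochain of local homomorphisms of a morphism `φ : E → Čⁿ(𝓤, M)`**: its `α`-component
over `W ≤ U_α` is `s ↦ φ_W(s)_α|_W` (`φ_W(s)_α ∈ Γ(M, W ⊓ U_α)`, and `W ⊓ U_α = W`). [folklore] -/
def familyOfHom (φ : E ⟶ obj U n M) : LocalFamily U n E M := fun α =>
  overHomMk
    (fun W k =>
      { toFun := fun s => res M (le_inf le_rfl k.le) ((φ.app W s : Sections U n M W) α)
        map_zero' := by rw [map_zero, obj_zero_apply, map_zero]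
        map_add' := fun s t => by rw [map_add, obj_add_apply, map_add] })
    (fun W k r s => by
      change res M _ ((φ.app W (r • s) : Sections U n M W) α) =
        r • res M _ ((φ.app W s : Sections U n M W) α)
      rw [Scheme.Modules.Hom.app_smul, obj_smul_apply, res_smul, resO_resO, resO_self])
    (fun W V k k' l s => by
      change res M _ ((φ.app V (E.presheaf.map l.op s) : Sections U n M V) α) =
        M.presheaf.map l.op (res M _ ((φ.app W s : Sections U n M W) α))
      rw [presheaf_map_eq_res l s, presheaf_map_eq_res l, app_res, obj_map_apply, res_res, res_res])

/-- Values of the components of `familyOfHom φ`. [folklore] -/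
@[simp] lemma appLE_familyOfHom (φ : E ⟶ obj U n M) (α : Fin (n + 1) → ι) {W : X.Opens}
    (k : W ⟶ face U α) (s : Γ(E, W)) :
    appLE (familyOfHom φ α) k s = res M (le_inf le_rfl k.le) ((φ.app W s : Sections U n M W) α) :=
  rfl

/-- `(familyOfHom φ)♯ = φ`. [folklore] -/
theorem familyHom_familyOfHom (φ : E ⟶ obj U n M) : familyHom (familyOfHom φ) = φ :=
  hom_ext_to fun W s α => by
    rw [familyHom_app_apply, appLE_familyOfHom, app_res, obj_map_apply, res_res, res_self]

/-- `familyOfHom (ω♯) = ω`. [folklore] -/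
theorem familyOfHom_familyHom (ω : LocalFamily U n E M) : familyOfHom (familyHom ω) = ω := by
  funext α
  refine hom_ext_of_appLE fun W k s => ?_
  rw [appLE_familyOfHom, familyHom_app_apply,
    appLE_congr_hom (ω α) (homOfLE inf_le_right) (homOfLE (inf_le_left : W ⊓ face U α ≤ W) ≫ k)]
  change res M _ (appLE (ω α) (homOfLE _ ≫ k) (E.presheaf.map (homOfLE _).op s)) = _
  rw [appLE_map, presheaf_map_eq_res (homOfLE (inf_le_left : W ⊓ face U α ≤ W)), res_res, res_self]

/-- **`ω ↦ ω♯` is injective** (indeed bijective, with inverse `familyOfHom`). [folklore] -/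
theorem familyHom_injective : Function.Injective (familyHom : LocalFamily U n E M → (E ⟶ obj U n M)) :=
  Function.LeftInverse.injective familyOfHom_familyHom

/-! ### Assembling local retractions into `X' → Č⁰(𝓥, M)` -/

section Retraction

variable {V : ι → X.Opens} (hVU : ∀ a, V a ≤ U a) {X' : X.Modules}
  (r : ∀ a, X'.over (V a) ⟶ (obj U 0 M).over (V a))

/-- **The morphism `ρ : X' → Č⁰(𝓥, M)` assembled from morphisms `r_a : X'|_{V_a} → Č⁰(𝓤, M)|_{V_a}`**:
`ρ_W(t)_a = (r_a(t|_{W ⊓ V_a}))_a|_{W ⊓ V_a}`. [folklore] -/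
def retractionHom : X' ⟶ obj V 0 M :=
  homMk
    (fun W t α => res M (le_inf le_rfl (inf_le_right.trans (face_mono hVU α)))
      ((appLE (r (α 0)) (homOfLE (inf_le_right.trans (face_le V α 0)))
        (res X' (inf_le_left : W ⊓ face V α ≤ W) t) : Sections U 0 M (W ⊓ face V α)) α))
    (fun W t t' => funext fun α => by
      rw [add_apply, map_add, appLE_add_right, obj_add_apply, map_add])
    (fun W c t => funext fun α => by
      rw [smul_apply, res_smul, appLE_smul_right, obj_smul_apply, res_smul, resO_resO, resO_self])
    (fun W W' i t => funext fun α => by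
      rw [restrict_apply, presheaf_map_eq_res i t, res_res,
        ← res_res (inf_le_left : W ⊓ face V α ≤ W) (inf_le_inf_right (face V α) i.le) t,
        appLE_congr_hom (r (α 0)) _
          (homOfLE (inf_le_inf_right (face V α) i.le) ≫ homOfLE (inf_le_right.trans (face_le V α 0)))]
      change res M _ ((appLE (r (α 0)) (homOfLE _ ≫ homOfLE _)
        (X'.presheaf.map (homOfLE _).op (res X' _ t)) : Sections U 0 M (W' ⊓ face V α)) α) = _
      rw [appLE_map, obj_map_apply, res_res, res_res])

/-- Components of `retractionHom`. [folklore] -/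
@[simp] lemma retractionHom_app_apply (W : X.Opens) (t : Γ(X', W)) (α : Fin 1 → ι) :
    ((retractionHom hVU r).app W t : Sections V 0 M W) α =
      res M (le_inf le_rfl (inf_le_right.trans (face_mono hVU α)))
        ((appLE (r (α 0)) (homOfLE (inf_le_right.trans (face_le V α 0)))
          (res X' (inf_le_left : W ⊓ face V α ≤ W) t) : Sections U 0 M (W ⊓ face V α)) α) :=
  rfl

/-- **If the `r_a` are retractions of `f|_{V_a}` for a morphism `f : Č⁰(𝓤, M) → X'`, the refinement
map factors as `refine⁰ = f ≫ ρ`.** [folklore] -/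
theorem comp_retractionHom (f : obj U 0 M ⟶ X')
    (hr : ∀ a, (Scheme.Modules.overFunctor (V a)).map f ≫ r a = 𝟙 _) :
    f ≫ retractionHom hVU r = refine M hVU 0 :=
  hom_ext_to fun W s α => by
    have hr' : (SheafOfModules.overFunctor X.ringCatSheaf (V (α 0))).map f ≫ r (α 0) = 𝟙 _ :=
      hr (α 0)
    rw [Scheme.Modules.Hom.comp_app, CategoryTheory.comp_apply, refine_app_apply,
      retractionHom_app_apply, ← app_res f,
      ← appLE_over_map f (homOfLE (inf_le_right.trans (face_le V α 0))), ← appLE_comp, hr',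
      appLE_id, obj_map_apply, res_res]

end Retraction

/-! ### The theorem -/

variable [HasExt.{u + 1} X.Modules]

/-- **A Čech `2`-cocycle of local homomorphisms with zero `Ext`-class is a coboundary on a
refinement.** Let `𝓤` cover `X` and let `ω` be a `2`-cocycle of local homomorphisms `E → M` on
`𝓤` with `[ω] = 0` in `Ext²(E, M)`. Suppose (local retraction oracle) that for every extension
`0 → Č⁰(𝓤, M) —f→ X' → E → 0` there is a covering refinement `𝓥 = (V_a ≤ U_a)_a` satisfying a
prescribed property `P` over whose members `f` is split. Then for some such `𝓥` and some
`1`-cochain `β` on `𝓥`, `ω|_𝓥 = dβ`. (For `E` finite locally free every extension by `E` splits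
near every point, which supplies the oracle.) [cite: Hartshorne1977, III Lemma 4.4] -/
theorem exists_refinement_eq_dFamily_of_classOf_eq_zero (hU : iSup U = ⊤)
    (ω : LocalFamily U 2 E M) (hω : dFamily ω = 0)
    (h0 : classOf (exactAugmentation U M hU) ω hω = 0)
    (P : (ι → X.Opens) → Prop)
    (oracle : ∀ (X' : X.Modules) (f : obj U 0 M ⟶ X') (g : X' ⟶ E) (w : f ≫ g = 0),
      (ShortComplex.mk f g w).ShortExact →
      ∃ V : ι → X.Opens, P V ∧ iSup V = ⊤ ∧ (∀ a, V a ≤ U a) ∧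
        ∀ a, ∃ r : X'.over (V a) ⟶ (obj U 0 M).over (V a),
          (Scheme.Modules.overFunctor (V a)).map f ≫ r = 𝟙 _) :
    ∃ V : ι → X.Opens, P V ∧ ∃ hVU : ∀ a, V a ≤ U a, ∃ β : LocalFamily V 1 E M,
      restrictFamily hVU ω = dFamily β := by
  -- Step 1: `θ(ω♯) = 0` lifts `[ω̄] ∘ [T₁]` to `y ∈ Ext¹(E, Č⁰(𝓤, M))`
  obtain ⟨y, hy⟩ := (exactAugmentation U M hU).exists_ext_one_of_theta_eq_zero (familyHom ω)
    (familyHom_comp_d_eq_zero ω hω) h0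
  -- Step 2: `y` is the class of an extension `0 → Č⁰(𝓤, M) → X' → E → 0`
  obtain ⟨X', f, g, w, hS, hSy⟩ :
      ∃ (X' : X.Modules) (f : obj U 0 M ⟶ X') (g : X' ⟶ E) (w : f ≫ g = 0)
        (h : (ShortComplex.mk f g w).ShortExact), h.extClass = y :=
    Literature.Algebra.Homology.Ext.exists_shortExact_extClass_eq y
  subst hSy
  -- Step 3: the oracle refines the cover and splits the extension over the `V_a`
  obtain ⟨V, hP, hV, hVU, hr⟩ := oracle X' f g w hS
  choose r hr using hr
  -- Step 4: `refine⁰ = f ≫ ρ`, so `[S] ∘ [refine⁰] = ([S] ∘ [f]) ∘ [ρ] = 0`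
  have hkill : hS.extClass.comp (Ext.mk₀ (refine M hVU 0)) (add_zero 1) = 0 := by
    rw [← comp_retractionHom hVU r f hr, ← Ext.mk₀_comp_mk₀]
    exact hS.extClass_comp_assoc _
  -- Step 5: `ω♯ ≫ refine² = β' ≫ d`
  obtain ⟨β', hβ'⟩ := (exactAugmentation U M hU).exists_eq_comp_d_of_comp_eq_zero
    (exactAugmentation V M hV) (refineChainMap M hVU) (familyHom ω)
    (familyHom_comp_d_eq_zero ω hω) hS.extClass hy hkill
  -- Step 6: `β' = β♯`
  refine ⟨V, hP, hVU, familyOfHom β', familyHom_injective ?_⟩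
  rw [familyHom_restrictFamily, ← familyHom_comp_d, familyHom_familyOfHom, ← complex_d]
  exact hβ'

end Cech

end Literature.AlgebraicGeometry.Modules

end
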